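import Mathlib.CategoryTheory.Groupoid.FreeGroupoid
import Mathlib.Combinatorics.Quiver.Subquiver
import Mathlib.CategoryTheory.SingleObj
import Mathlib.GroupTheory.FreeGroup.Basic
import HarnessLib

/-!
# Words of zigzag paths and the normal form for free groupoids of quivers

Stallings, *Topology of finite graphs*, Invent. Math. **71** (1983) 551–565, §2.2–2.3 (p. 553)
and Prop. 5.2 "Uniqueness of reduced paths" (p. 557) [cite: Stallings1983, §2.2-2.3 p.553; Prop. 5.2 p.557].

Mathlib's free groupoid `Quiver.FreeGroupoid V` of a quiver `V` is the quotient of the path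
category of the symmetrified quiver `Quiver.Symmetrify V` (one formal inverse for each arrow) by
the congruence generated by the round trips `f ≫ f⁻¹ ∼ 𝟙` (Stallings' "homotopy" of paths,
§2.2).  Mathlib provides the universal property (`Quiver.FreeGroupoid.lift`) but no normal form.
This file supplies it, following Stallings' proof of Prop. 5.2 *verbatim*: "Let `Δ` be the result
of identifying all vertices of `Γ` to one vertex … By the theory of free groups, 2.3, it follows
that `f p = f q`":

* `letter f`, `word p` — the letter `(e, ±)` of a (formal ± ) arrow and the word of a zigzag path,
  in the free group `FreeGroup (Letter V)` on ALL arrows of `V` (= `π₁` of the one-vertex quotient);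
* `wordFunctor V : FreeGroupoid V ⥤ SingleObj (FreeGroup (Letter V))` (via `FreeGroupoid.lift`)
  with `wordFunctor_map_homMk : (wordFunctor V).map [p] = FreeGroup.mk (word p)`;
* `IsReduced p` (no round trip `f, f⁻¹`; = the word is a reduced word), existence
  (`exists_isReduced_homMk_eq`) and uniqueness (`eq_of_isReduced`, Stallings Prop. 5.2) of reduced
  representatives of a morphism of the free groupoid, via Mathlib's Church–Rosser theorem for
  `FreeGroup.Red`;
* faithfulness of the word functor (`wordFunctor_map_injective`).

Deliberately NOT here: immersions and coverings of quivers (Stallings §3–§5: `FreeGroupoidImmersions`),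
fundamental groups of (semi-)graphs.
-/

namespace Literature.GroupTheory.CombinatorialGroupTheory

namespace FreeGroupoidWords

open CategoryTheory Quiver

universe v u

variable {V : Type u} [Quiver.{v} V]

/-! ### Letters and words -/

/-- The letters: all arrows of the quiver `V` (the edges of the one-vertex quotient graph in
Stallings' proof of Prop. 5.2). [cite: Stallings1983, Prop. 5.2 p.557] -/
abbrev Letter (V : Type u) [Quiver.{v} V] : Type (max u v) := Σ (a : V) (b : V), (a ⟶ b)

/-- The signed letter of a formal (±) arrow of the symmetrified quiver: `(e, true)` for the forward
copy of `e`, `(e, false)` for its formal inverse (Stallings §2.1: the edge `ē`).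
[cite: Stallings1983, §2.1-2.2 p.553] -/
def letter : ∀ {X Y : Symmetrify V}, (X ⟶ Y) → Letter V × Bool
  | _, _, Sum.inl e => (⟨_, _, e⟩, true)
  | _, _, Sum.inr e => (⟨_, _, e⟩, false)

/-- The letter of a forward arrow. [cite: Stallings1983, §2.1 p.553] -/
@[simp] theorem letter_inl {X Y : V} (e : X ⟶ Y) :
    letter (Sum.inl e : (Quiver.symmetrifyQuiver V).Hom X Y) = (⟨X, Y, e⟩, true) := rfl

/-- The letter of a backward arrow. [cite: Stallings1983, §2.1 p.553] -/
@[simp] theorem letter_inr {X Y : V} (e : X ⟶ Y) :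
    letter (Sum.inr e : (Quiver.symmetrifyQuiver V).Hom Y X) = (⟨X, Y, e⟩, false) := rfl

/-- Reversing an arrow flips the sign of its letter and keeps the underlying edge
(`letter ē = (e, ¬±)`). [cite: Stallings1983, §2.2 p.553] -/
theorem letter_reverse {X Y : Symmetrify V} (f : X ⟶ Y) :
    letter (Quiver.reverse f) = ((letter f).1, !(letter f).2) := by
  cases f <;> rfl

/-- Two formal arrows with the same letter are the same arrow (with the same end-points).
[cite: Stallings1983, §2.1 p.553] -/
theorem total_eq_of_letter_eq {X Y X' Y' : Symmetrify V} (f : X ⟶ Y) (g : X' ⟶ Y')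
    (h : letter f = letter g) :
    (⟨X, Y, f⟩ : Quiver.Total (Symmetrify V)) = ⟨X', Y', g⟩ := by
  cases f with
  | inl e =>
    cases g with
    | inl e' =>
      simp only [letter, Prod.mk.injEq, and_true] at h
      obtain ⟨rfl, h⟩ := Sigma.mk.inj_iff.mp h
      obtain ⟨rfl, h⟩ := Sigma.mk.inj_iff.mp (eq_of_heq h)
      cases eq_of_heq h
      rfl
    | inr e' => simp [letter] at h
  | inr e =>
    cases g with
    | inl e' => simp [letter] at h
    | inr e' =>
      simp only [letter, Prod.mk.injEq, and_true] at h
      obtain ⟨rfl, h⟩ := (Sigma.mk.inj_iff.mp h)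
      obtain ⟨rfl, h⟩ := (Sigma.mk.inj_iff.mp (eq_of_heq h))
      cases eq_of_heq h
      rfl

/-- The word of a zigzag path (a path in the symmetrified quiver), listed from the LAST arrow to
the first (so that concatenation of paths becomes multiplication in `SingleObj`).
[cite: Stallings1983, §2.1-2.3 p.553] -/
def word {X : Symmetrify V} : ∀ {Y : Symmetrify V}, Path X Y → List (Letter V × Bool)
  | _, Path.nil => []
  | _, Path.cons p f => letter f :: word p

/-- The word of the empty path. [cite: Stallings1983, §2.1 p.553] -/
@[simp] theorem word_nil (X : Symmetrify V) : word (Path.nil : Path X X) = [] := rfl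

/-- The word of an extended path. [cite: Stallings1983, §2.1 p.553] -/
@[simp] theorem word_cons {X Y Z : Symmetrify V} (p : Path X Y) (f : Y ⟶ Z) :
    word (p.cons f) = letter f :: word p := rfl

/-- The length of the word is the length of the path. [cite: Stallings1983, §2.1 p.553] -/
theorem length_word {X : Symmetrify V} : ∀ {Y : Symmetrify V} (p : Path X Y),
    (word p).length = p.length
  | _, Path.nil => rfl
  | _, Path.cons p _ => by simp [length_word p]

/-- A zigzag path is determined by its starting point and its word ("a path `p` is a map of graphs
`p : Δ_n → Γ` such that `p(0) = u`", §2.1). [cite: Stallings1983, §2.1 p.553] -/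
theorem word_injective {X : Symmetrify V} : ∀ {Y : Symmetrify V} (p q : Path X Y),
    word p = word q → p = q
  | _, Path.nil, Path.nil, _ => rfl
  | _, Path.nil, Path.cons q g, h => by simp at h
  | _, Path.cons p f, Path.nil, h => by simp at h
  | _, Path.cons (b := Y₁) p f, Path.cons (b := Y₂) q g, h => by
    simp only [word_cons, List.cons.injEq] at h
    obtain ⟨h₁, h₂⟩ := h
    have ht := total_eq_of_letter_eq f g h₁
    cases ht
    rw [word_injective p q h₂]

/-! ### The free groupoid: morphisms represented by zigzag paths -/

/-- A vertex as an object of the path category of the symmetrified quiver.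
[cite: Stallings1983, §2.1 p.553] -/
abbrev pathsObj (X : Symmetrify V) : Paths (Symmetrify V) := (Paths.of (Symmetrify V)).obj X

/-- A zigzag path as a morphism of the path category of the symmetrified quiver (Stallings' category
`P(Γ)`, §2.1). [cite: Stallings1983, §2.1 p.553] -/
abbrev pathsHom {X Y : Symmetrify V} (p : Path X Y) : pathsObj X ⟶ pathsObj Y := p

/-- The object of the free groupoid at a vertex. [cite: Stallings1983, §2.2 p.553] -/
abbrev obj (X : Symmetrify V) : Quiver.FreeGroupoid V :=
  (CategoryTheory.Quotient.functor (@Quiver.FreeGroupoid.redStep V _)).obj (pathsObj X)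

/-- The morphism of the free groupoid represented by a zigzag path (its "homotopy class", §2.2).
[cite: Stallings1983, §2.2 p.553] -/
abbrev homMk {X Y : Symmetrify V} (p : Path X Y) : obj X ⟶ obj Y :=
  (CategoryTheory.Quotient.functor (@Quiver.FreeGroupoid.redStep V _)).map (pathsHom p)

/-- Every morphism of the free groupoid is represented by a zigzag path.
[cite: Stallings1983, §2.2 p.553] -/
theorem homMk_surjective {X Y : Symmetrify V} (f : obj X ⟶ obj Y) : ∃ p : Path X Y, homMk p = f :=
  Quot.exists_rep f

/-- The empty path represents the identity. [cite: Stallings1983, §2.2 p.553] -/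
@[simp] theorem homMk_nil (X : Symmetrify V) : homMk (Path.nil : Path X X) = 𝟙 (obj X) :=
  CategoryTheory.Functor.map_id _ _

/-- Extending a path composes with the class of the new arrow. [cite: Stallings1983, §2.2 p.553] -/
theorem homMk_cons {X Y Z : Symmetrify V} (p : Path X Y) (f : Y ⟶ Z) :
    homMk (p.cons f) = homMk p ≫ homMk f.toPath := by
  unfold homMk
  rw [← CategoryTheory.Functor.map_comp]
  rfl

/-- Concatenation of paths is composition. [cite: Stallings1983, §2.2 p.553] -/
theorem homMk_comp {X Y Z : Symmetrify V} (p : Path X Y) (q : Path Y Z) :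
    homMk (p.comp q) = homMk p ≫ homMk q := by
  unfold homMk
  rw [← CategoryTheory.Functor.map_comp]
  rfl

/-- A round trip `f, f̄` is the identity in the free groupoid (Stallings' elementary reduction,
§2.2). [cite: Stallings1983, §2.2 p.553] -/
theorem homMk_toPath_comp_reverse {X Y : Symmetrify V} (f : X ⟶ Y) :
    homMk (f.toPath.comp (Quiver.reverse f).toPath) = 𝟙 (obj X) := by
  have h := CategoryTheory.Quotient.sound Quiver.FreeGroupoid.redStep
    (Quiver.FreeGroupoid.redStep.step X Y f)
  rw [CategoryTheory.Functor.map_id] at h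
  exact h.symm

/-! ### The word functor (the free group on all edges, Stallings' one-vertex quotient) -/

variable (V) in
/-- The word functor: the free groupoid of `V` mapped to the free group on all arrows of `V`
(the fundamental group of the graph obtained "identifying all vertices of `Γ` to one vertex",
proof of Prop. 5.2), by the universal property of the free groupoid.
[cite: Stallings1983, Prop. 5.2 p.557] -/
noncomputable def wordFunctor :
    Quiver.FreeGroupoid V ⥤ CategoryTheory.SingleObj (FreeGroup (Letter V)) :=
  Quiver.FreeGroupoid.lift
    { obj := fun _ => CategoryTheory.SingleObj.star (FreeGroup (Letter V))
      map := fun {a b} e => FreeGroup.of (⟨a, b, e⟩ : Letter V) }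

/-- The word functor on the class of a single formal arrow. [cite: Stallings1983, Prop. 5.2 p.557] -/
theorem wordFunctor_map_homMk_toPath {X Y : Symmetrify V} (f : X ⟶ Y) :
    (wordFunctor V).map (homMk f.toPath) = FreeGroup.mk [letter f] := by
  change (Paths.lift (Symmetrify.lift _)).map f.toPath = _
  rw [Paths.lift_toPath]
  cases f with
  | inl e => rfl
  | inr e => rfl

/-- **The word of a path computes the word functor**: `W[p] = mk (word p)`.
[cite: Stallings1983, Prop. 5.2 p.557] -/
theorem wordFunctor_map_homMk {X : Symmetrify V} : ∀ {Y : Symmetrify V} (p : Path X Y),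
    (wordFunctor V).map (homMk p) = FreeGroup.mk (word p)
  | _, Path.nil => by
    rw [homMk_nil, CategoryTheory.Functor.map_id, SingleObj.id_as_one, word_nil, FreeGroup.one_eq_mk]
  | _, Path.cons p f => by
    rw [homMk_cons, CategoryTheory.Functor.map_comp, SingleObj.comp_as_mul, wordFunctor_map_homMk p,
      wordFunctor_map_homMk_toPath, FreeGroup.mul_mk, word_cons]
    rfl

/-! ### Reduced paths: existence and uniqueness (Stallings Prop. 5.2) -/

/-- A zigzag path is *reduced* if it contains no round trip `f, f̄` (§2.3), i.e. its word is a
reduced word of the free group. [cite: Stallings1983, §2.3 p.553] -/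
def IsReduced {X Y : Symmetrify V} (p : Path X Y) : Prop := FreeGroup.IsReduced (word p)

/-- The empty path is reduced. [cite: Stallings1983, §2.3 p.553] -/
theorem IsReduced.nil (X : Symmetrify V) : IsReduced (Path.nil : Path X X) :=
  FreeGroup.IsReduced.nil

/-- A one-arrow path is reduced. [cite: Stallings1983, §2.3 p.553] -/
theorem IsReduced.toPath {X Y : Symmetrify V} (f : X ⟶ Y) : IsReduced f.toPath :=
  FreeGroup.IsReduced.singleton

/-- A reduced path stays reduced after removing its last arrow. [cite: Stallings1983, §2.3 p.553] -/
theorem IsReduced.of_cons {X Y Z : Symmetrify V} {p : Path X Y} {f : Y ⟶ Z}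
    (h : IsReduced (p.cons f)) : IsReduced p := by
  unfold IsReduced at h ⊢
  rw [word_cons] at h
  exact List.IsChain.tail h

/-- Reducedness of a path with at least two arrows: the last two arrows are not a round trip and
the rest is reduced. [cite: Stallings1983, §2.3 p.553] -/
theorem isReduced_cons_cons_iff {X Y Z W : Symmetrify V} (p : Path X Y) (f : Y ⟶ Z) (g : Z ⟶ W) :
    IsReduced ((p.cons f).cons g) ↔
      ((letter g).1 = (letter f).1 → (letter g).2 = (letter f).2) ∧ IsReduced (p.cons f) :=
  FreeGroup.isReduced_cons_cons

/-- If the last two arrows `f, g` of a path have the same edge with opposite signs, then `g = f̄`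
and the two arrows cancel in the free groupoid. [cite: Stallings1983, §2.2 p.553] -/
theorem homMk_cons_cons_of_clash {X Y Z W : Symmetrify V} (p : Path X Y) (f : Y ⟶ Z) (g : Z ⟶ W)
    (h₁ : (letter g).1 = (letter f).1) (h₂ : (letter g).2 ≠ (letter f).2) :
    ∃ h : W = Y, h ▸ homMk ((p.cons f).cons g) = homMk p := by
  have hl : letter g = letter (Quiver.reverse f) := by
    rw [letter_reverse]
    exact Prod.ext h₁ (Bool.eq_not.mpr h₂)
  have ht := total_eq_of_letter_eq g (Quiver.reverse f) hl
  cases ht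
  refine ⟨rfl, ?_⟩
  change homMk ((p.cons f).cons (Quiver.reverse f)) = homMk p
  have e1 : (p.cons f).cons (Quiver.reverse f) = p.comp (f.toPath.comp (Quiver.reverse f).toPath) :=
    rfl
  rw [e1, homMk_comp, homMk_toPath_comp_reverse, Category.comp_id]

/-- **Existence of reduced representatives**: "Every path is clearly homotopic to some reduced
path" (§2.3). [cite: Stallings1983, §2.3 p.553] -/
theorem exists_isReduced_homMk_eq_homMk {X : Symmetrify V} :
    ∀ {Y : Symmetrify V} (p : Path X Y), ∃ r : Path X Y, IsReduced r ∧ homMk r = homMk p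
  | _, Path.nil => ⟨Path.nil, IsReduced.nil X, rfl⟩
  | _, Path.cons p g => by
    obtain ⟨r, hr, hrp⟩ := exists_isReduced_homMk_eq_homMk p
    cases r with
    | nil => exact ⟨Path.nil.cons g, IsReduced.toPath g, by rw [homMk_cons, homMk_cons, hrp]⟩
    | cons r' f =>
      by_cases hc : (letter g).1 = (letter f).1 → (letter g).2 = (letter f).2
      · exact ⟨(r'.cons f).cons g, (isReduced_cons_cons_iff r' f g).mpr ⟨hc, hr⟩,
          by rw [homMk_cons, hrp, ← homMk_cons]⟩
      · rw [Classical.not_imp] at hc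
        obtain ⟨h, hh⟩ := homMk_cons_cons_of_clash r' f g hc.1 hc.2
        cases h
        refine ⟨r', hr.of_cons, ?_⟩
        rw [homMk_cons, ← hrp, ← homMk_cons]
        exact hh.symm

/-- Every morphism of the free groupoid has a reduced representative. [cite: Stallings1983, §2.3 p.553] -/
theorem exists_isReduced_homMk_eq {X Y : Symmetrify V} (f : obj X ⟶ obj Y) :
    ∃ r : Path X Y, IsReduced r ∧ homMk r = f := by
  obtain ⟨p, rfl⟩ := homMk_surjective f
  exact exists_isReduced_homMk_eq_homMk p

/-- **Stallings Prop. 5.2 (Uniqueness of reduced paths)**: "If `Γ` is any graph, and if `p` and `q`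
are reduced, homotopic paths in `Γ`, then `p = q`."  Proof as printed: map to the free group on
the edges of the one-vertex quotient and use the word problem for free groups (Mathlib's
Church–Rosser theorem `FreeGroup.Red.exact`). [cite: Stallings1983, Prop. 5.2 p.557] -/
theorem eq_of_isReduced {X Y : Symmetrify V} {p q : Path X Y} (hp : IsReduced p) (hq : IsReduced q)
    (h : homMk p = homMk q) : p = q := by
  have hw : FreeGroup.mk (word p) = FreeGroup.mk (word q) := by
    rw [← wordFunctor_map_homMk, ← wordFunctor_map_homMk, h]
  obtain ⟨L, hpL, hqL⟩ := FreeGroup.Red.exact.mp hw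
  have h1 : L = word p := (FreeGroup.IsReduced.red_iff_eq hp).mp hpL
  have h2 : L = word q := (FreeGroup.IsReduced.red_iff_eq hq).mp hqL
  exact word_injective p q (h1.symm.trans h2)

/-- Every morphism of the free groupoid has a UNIQUE reduced representative (§2.3 with Prop. 5.2).
[cite: Stallings1983, Prop. 5.2 p.557] -/
theorem existsUnique_isReduced_homMk_eq {X Y : Symmetrify V} (f : obj X ⟶ obj Y) :
    ∃! r : Path X Y, IsReduced r ∧ homMk r = f := by
  obtain ⟨r, hr, hrf⟩ := exists_isReduced_homMk_eq f
  exact ⟨r, ⟨hr, hrf⟩, fun r' hr' => eq_of_isReduced hr'.1 hr (hr'.2.trans hrf.symm)⟩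

/-- **Faithfulness of the word functor**: two morphisms of the free groupoid with the same word in
the free group on all edges are equal (the content of Stallings' proof of Prop. 5.2).
[cite: Stallings1983, Prop. 5.2 p.557] -/
theorem wordFunctor_map_injective {X Y : Symmetrify V} :
    Function.Injective ((wordFunctor V).map :
      (obj X ⟶ obj Y) → ((wordFunctor V).obj (obj X) ⟶ (wordFunctor V).obj (obj Y))) := by
  intro f g hfg
  obtain ⟨p, hp, rfl⟩ := exists_isReduced_homMk_eq f
  obtain ⟨q, hq, rfl⟩ := exists_isReduced_homMk_eq g
  have hw : FreeGroup.mk (word p) = FreeGroup.mk (word q) := by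
    rw [← wordFunctor_map_homMk, ← wordFunctor_map_homMk]
    exact hfg
  obtain ⟨L, hpL, hqL⟩ := FreeGroup.Red.exact.mp hw
  have h1 : L = word p := (FreeGroup.IsReduced.red_iff_eq hp).mp hpL
  have h2 : L = word q := (FreeGroup.IsReduced.red_iff_eq hq).mp hqL
  rw [word_injective p q (h1.symm.trans h2)]

/-- A morphism of the free groupoid is the identity iff its word is trivial; in particular a
reduced NONEMPTY loop is not the identity (used in Stallings Prop. 5.3).
[cite: Stallings1983, Prop. 5.3 p.557] -/
theorem homMk_eq_id_iff {X : Symmetrify V} (p : Path X X) (hp : IsReduced p) :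
    homMk p = 𝟙 (obj X) ↔ p = Path.nil := by
  constructor
  · intro h
    rw [← homMk_nil] at h
    exact eq_of_isReduced hp (IsReduced.nil X) h
  · rintro rfl
    exact homMk_nil X

end FreeGroupoidWords

end Literature.GroupTheory.CombinatorialGroupTheory
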